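import Summits.AnomalousDissipation.AnomalousDissipation.Theorems.MomentParityResolvedDissipationSmallDataDirac
import Summits.AnomalousDissipation.AnomalousDissipation.Theorems.MomentParityResolvedDissipationSmallDataSteady
import Summits.AnomalousDissipation.AnomalousDissipation.Theorems.MomentParityResolvedDissipationSmallData
import Literature.Analysis.FluidPDE.StatisticalSolutionEnergyEq
import Literature.Analysis.FluidPDE.CylindricalGenerator

/-!
# `MomentParity.ResolvedDissipation` (stmt-AnomalousDissipation-14284), line `lions-l4-domination`:
# the hard stub K1′ (mean maximal energy flux) holds in the laminar regime `‖f‖₂ ≤ ν²/4`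

Supports stmt-AnomalousDissipation-14284 (helper of the line lead; nothing here closes an item).

`uniformMaximalFlux_smallForce`: the statement of the hard stub `stub_uniformMaximalFlux` (K1′) of line
`lions-l4-domination` — an `N`-uniform bound on the mean MAXIMAL ENERGY FLUX
`∫ sup_m |Π_m(u)| dμ ≤ C(f, ν, R)`, `Π_m(u) = ∫ (u ⊗ u) : ∇P_m u = Torus.inertialPairing u (P_m u)`, over all
admissible laws (probability, level-`N` carried, supported in `‖u‖ ≤ R`, stationary for Galerkin NS at
`(ν, f)` against all polynomial cylindrical band-limited observables) — PROVED for forces with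
`∫‖f‖² ≤ ν⁴/16`. By seat 0's laminar analysis every level has a Galerkin steady state `s_N` with
`‖P_N s_N‖_∞ ≤ ν ≤ πν` and `‖∇s_N‖² ≤ ν²` (`exists_small_galerkinSteady`), and every admissible law
(3-stationarity suffices) is the Dirac mass at `s_N` (`ae_eq_of_galerkinSteady_of_sup_le`); so the mean maximal
flux is the maximal flux OF `s_N`. At a Galerkin steady state every truncation `P_m s` is a level-`N` band test,
whence the flux identity `Π_m(s) = ν‖∇P_m s‖² − (f, P_m s)` (`inertialPairing_fourierTruncate_eq_of_galerkinSteady`)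
and the `m`- and `N`-uniform bound `|Π_m(s)| ≤ ½(∫‖f‖² + ν²) + ν·ν²` (Bessel, Poincaré on `H`, `‖∇s‖² ≤ ν²`).
Outside the laminar regime K1′ is the open content of the crux.
-/

noncomputable section

-- `Summit.<Summit>.<Problem>`: single-conjunct summit, the duplicate namespace segment is mandated.
set_option linter.dupNamespace false

namespace Summit.AnomalousDissipation.AnomalousDissipation.Theorems.MomentParityResolvedDissipation

open MeasureTheory Filter Topology
open scoped ENNReal NNReal InnerProductSpace RealInnerProductSpace
open Literature.Analysis.FunctionSpaces Literature.Analysis.FluidPDE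
open Summit.AnomalousDissipation.AnomalousDissipation.Theses.MomentParity
open Summit.AnomalousDissipation.AnomalousDissipation.Theorems.CubicParityLoud.Negative (T3 R3 H3 L2T3)
open Summit.AnomalousDissipation.AnomalousDissipation.Theorems.QuarticGate.Negative
  (IsLevel IsBandTest polyGrad IsPolyStationary)
open Summit.AnomalousDissipation.AnomalousDissipation.Theorems.UniformResolution.Negative
  (IsGalerkinSteady coef trunc trunc_eq integrable_coe coef_zero isBandTest_trunc)

/-! ## Fluxes at a Galerkin steady state -/

/-- Every truncation `P_m s` of a level-`N` field `s ∈ H` is a level-`N` band test (its coefficients are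
those of `s` on the ball of radius `m` and vanish elsewhere). [folklore] -/
theorem isBandTest_trunc_of_isLevel {N m : ℕ} {s : H3} (hs : IsLevel N s) : IsBandTest N (trunc m s) := by
  obtain ⟨h1, h2, h3, -⟩ := isBandTest_trunc (N := m) s
  refine ⟨h1, h2, h3, fun k hk => ?_⟩
  change UnitAddTorus.mFourierCoeff (EuclideanSpace.complexify ∘ Torus.fourierTruncate m _) k = 0
  rw [Torus.mFourierCoeff_fourierTruncate (integrable_coe s)]
  split_ifs
  · exact hs k hk
  · rfl

/-- **The flux identity at a Galerkin steady state**: if `s ∈ H` is level-`N` and Galerkin-steady at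
`(ν, f)`, then for EVERY cutoff `m` the energy flux through the modes `|k| ≤ m` is
`Π_m(s) = ν‖∇P_m s‖² − (f, P_m s)` (the generator row tested with the band test `P_m s`). [folklore] -/
theorem inertialPairing_fourierTruncate_eq_of_galerkinSteady {ν : ℝ} {f : T3 → R3} {N : ℕ} {s : H3}
    (hs : IsLevel N s) (hst : IsGalerkinSteady ν f N s) (m : ℕ) :
    Torus.inertialPairing (s.1 : L2T3) (Torus.fourierTruncate m ((s.1 : L2T3) : T3 → R3)) =
      ν * (Torus.eGradNormSq (Torus.fourierTruncate m ((s.1 : L2T3) : T3 → R3))).toReal -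
        ∫ x, ⟪f x, Torus.fourierTruncate m ((s.1 : L2T3) : T3 → R3) x⟫_ℝ := by
  have h0 := hst (trunc m s) (isBandTest_trunc_of_isLevel hs)
  have h1 := Torus.nsGeneratorPairing_smul_fourierTruncate ν f s 1 m
  have e : (fun x => (1 : ℝ) • Torus.fourierTruncate m ((s.1 : L2T3) : T3 → R3) x) = trunc m s :=
    funext fun x => one_smul _ _
  rw [e, h0, one_mul] at h1
  linarith

/-- **Fluxes of a small steady state are uniformly bounded**: for `ν > 0`, `f` smooth and a level-`N`
Galerkin steady state `s` at `(ν, f)` with `‖∇s‖² ≤ ν²`, every flux satisfies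
`|Π_m(s)| ≤ ½(∫‖f‖² + ν²) + ν·ν²` (flux identity, `‖∇P_m s‖² ≤ ‖∇s‖²`, `|(f, P_m s)| ≤ ½(‖f‖² + ‖P_m s‖²)`,
Bessel and Poincaré `‖s‖² ≤ ‖∇s‖²/(4π²) ≤ ν²`). [folklore] -/
theorem abs_inertialPairing_fourierTruncate_le_of_galerkinSteady {ν : ℝ} (hν : 0 < ν) {f : T3 → R3}
    (hf : Torus.IsSmooth f) {N : ℕ} {s : H3} (hs : IsLevel N s) (hst : IsGalerkinSteady ν f N s)
    (hZ : Torus.eGradNormSq ((s.1 : L2T3) : T3 → R3) ≤ ENNReal.ofReal (ν ^ 2)) (m : ℕ) :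
    |Torus.inertialPairing (s.1 : L2T3) (Torus.fourierTruncate m ((s.1 : L2T3) : T3 → R3))| ≤
      2⁻¹ * ((∫ x, ‖f x‖ ^ 2) + ν ^ 2) + ν * ν ^ 2 := by
  rw [inertialPairing_fourierTruncate_eq_of_galerkinSteady hs hst m]
  have hint : Integrable ((s.1 : L2T3) : T3 → R3) volume := integrable_coe s
  have hmem : MemLp ((s.1 : L2T3) : T3 → R3) 2 volume := Lp.memLp _
  set Zm : ℝ := (Torus.eGradNormSq (Torus.fourierTruncate m ((s.1 : L2T3) : T3 → R3))).toReal with hZm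
  set F : ℝ := ∫ x, ⟪f x, Torus.fourierTruncate m ((s.1 : L2T3) : T3 → R3) x⟫_ℝ with hF
  -- the truncated enstrophy
  have hZm1 : Zm ≤ ν ^ 2 :=
    ENNReal.toReal_le_of_le_ofReal (by positivity) ((Torus.eGradNormSq_fourierTruncate_le hint m).trans hZ)
  have hZm0 : 0 ≤ Zm := ENNReal.toReal_nonneg
  -- the force term: Cauchy–Schwarz/Young, Bessel, Poincaré
  have hB : ∫ x, ‖Torus.fourierTruncate m ((s.1 : L2T3) : T3 → R3) x‖ ^ 2 ≤ ν ^ 2 := by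
    refine (Torus.integral_norm_sq_fourierTruncate_le hmem m).trans ?_
    have hfin : Torus.eGradNormSq ((s.1 : L2T3) : T3 → R3) ≠ ⊤ := ne_top_of_le_ne_top ENNReal.ofReal_ne_top hZ
    have hP := Torus.norm_sq_le_toReal_eGradNormSq s hfin
    have hZr : (Torus.eGradNormSq ((s.1 : L2T3) : T3 → R3)).toReal ≤ ν ^ 2 :=
      ENNReal.toReal_le_of_le_ofReal (by positivity) hZ
    rw [Torus.integral_norm_sq_coe_eq]
    have hn : ‖(s.1 : L2T3)‖ = ‖s‖ := rfl
    have hpi : (1 : ℝ) ≤ 4 * Real.pi ^ 2 := by nlinarith [Real.pi_gt_three]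
    have h1 : ‖s‖ ^ 2 ≤ 4 * Real.pi ^ 2 * ‖s‖ ^ 2 := le_mul_of_one_le_left (sq_nonneg _) hpi
    rw [hn]
    linarith
  have hFle : |F| ≤ 2⁻¹ * ((∫ x, ‖f x‖ ^ 2) + ν ^ 2) := by
    refine (Torus.abs_integral_inner_le (hf.memLp 2)
      (Torus.memLp_fourierTruncate m ((s.1 : L2T3) : T3 → R3) 2)).trans ?_
    have h2 : (0 : ℝ) ≤ 2⁻¹ := by norm_num
    exact mul_le_mul_of_nonneg_left (by linarith) h2
  -- combine
  have hνZ : |ν * Zm| ≤ ν * ν ^ 2 := by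
    rw [abs_of_nonneg (mul_nonneg hν.le hZm0)]
    exact mul_le_mul_of_nonneg_left hZm1 hν.le
  calc |ν * Zm - F| ≤ |ν * Zm| + |F| := abs_sub _ _
    _ ≤ ν * ν ^ 2 + 2⁻¹ * ((∫ x, ‖f x‖ ^ 2) + ν ^ 2) := add_le_add hνZ hFle
    _ = 2⁻¹ * ((∫ x, ‖f x‖ ^ 2) + ν ^ 2) + ν * ν ^ 2 := add_comm _ _

/-! ## The hard stub K1′ in the laminar regime -/

/-- **The hard stub K1′ of line `lions-l4-domination` in the laminar regime.** For every smooth force `f`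
and `ν > 0` with `∫‖f‖² ≤ ν⁴/16` and every `R` there is ONE constant `C` (namely
`C = ½(∫‖f‖² + ν²) + ν³`, independent of `R` and of the level) such that EVERY probability law on `H`
carried by level-`N` fields, supported in `‖u‖ ≤ R` and stationary for Galerkin NS at `(ν, f)` at every
polynomial order has mean maximal energy flux `∫ sup_m |∫ (u ⊗ u) : ∇P_m u| dμ ≤ C`, for every `N`: such laws
are Dirac masses at the unique small Galerkin steady state (`ae_eq_of_galerkinSteady_of_sup_le`,
`exists_small_galerkinSteady`), whose fluxes are bounded by `C` uniformly in the cutoff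
(`abs_inertialPairing_fourierTruncate_le_of_galerkinSteady`).
[cite: Temam1979, Ch. II Thm. 1.3 (small-data uniqueness), ensemble form] -/
theorem uniformMaximalFlux_smallForce :
    ∀ f : UnitAddTorus (Fin 3) → EuclideanSpace ℝ (Fin 3), Torus.IsSmooth f →
      ∀ ν : ℝ, 0 < ν → ∫ x, ‖f x‖ ^ 2 ≤ ν ^ 4 / 16 → ∀ R : ℝ, ∃ C : ℝ≥0,
        ∀ (N : ℕ) (μ : Measure (Torus.energySpace (Fin 3))), IsProbabilityMeasure μ →
          (∀ᵐ u ∂μ, IsLevel N u) → (∀ᵐ u ∂μ, ‖u‖ ≤ R) → (∀ d : ℕ, IsPolyStationary ν f N d μ) →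
          ∫⁻ u, (⨆ m : ℕ, ‖Torus.inertialPairing u.1 (Torus.fourierTruncate m
              (u.1 : UnitAddTorus (Fin 3) → EuclideanSpace ℝ (Fin 3)))‖ₑ) ∂μ ≤ C := by
  intro f hf ν hν hsmall _R
  set c : ℝ := 2⁻¹ * ((∫ x, ‖f x‖ ^ 2) + ν ^ 2) + ν * ν ^ 2 with hc
  refine ⟨c.toNNReal, fun N μ _ hL _ hS => ?_⟩
  obtain ⟨s, hs, hst, hsup, hZ⟩ := exists_small_galerkinSteady hν hf hsmall N
  have hπν : ν ≤ Real.pi * ν := by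
    have : (1 : ℝ) ≤ Real.pi := by linarith [Real.pi_gt_three]
    nlinarith
  have hae := ae_eq_of_galerkinSteady_of_sup_le hν hf hL (hS 3) hs hst hsup hπν
  -- the integrand is a.e. the constant `Π*(s)`
  have hconst : (fun u : H3 => ⨆ m : ℕ, ‖Torus.inertialPairing u.1 (Torus.fourierTruncate m
      ((u.1 : L2T3) : T3 → R3))‖ₑ) =ᵐ[μ] fun _ => ⨆ m : ℕ, ‖Torus.inertialPairing s.1
      (Torus.fourierTruncate m ((s.1 : L2T3) : T3 → R3))‖ₑ := by
    filter_upwards [hae] with u hu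
    rw [hu]
  rw [lintegral_congr_ae hconst, lintegral_const, measure_univ, mul_one]
  have hC : ((c.toNNReal : ℝ≥0) : ℝ≥0∞) = ENNReal.ofReal c := rfl
  rw [hC]
  refine iSup_le fun m => ?_
  rw [Real.enorm_eq_ofReal_abs]
  exact ENNReal.ofReal_le_ofReal (abs_inertialPairing_fourierTruncate_le_of_galerkinSteady hν hf hs hst hZ m)

end Summit.AnomalousDissipation.AnomalousDissipation.Theorems.MomentParityResolvedDissipation

end
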